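import Summits.CriticalPhenomena.SAWScalingLimit.Theorems.SAWDevelopingMapNoFoldBoundPeelFarPhase
import Summits.CriticalPhenomena.SAWScalingLimit.Theorems.SAWDevelopingMapNoFoldBoundPeelDirection
import Summits.CriticalPhenomena.SAWScalingLimit.Theorems.SAWDevelopingMapNoFoldBoundPeelFlux
import Literature.Probability.RandomPlanarGeometry.HexParafermionSpinShift

/-!
# Far positivity: the far side of a Duminil-Copin–Smirnov row has a signed real part

Helper file for the crux `NoFoldBound` (stmt-CriticalPhenomena-8296) of the route `SAWDevelopingMap`
(sub-problem `SAWScalingLimit` of `CriticalPhenomena`), programme FLAT / PEELED LP of the lead seats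
c9–c10 (`FLAT-LEAN-DESIGN.md` on the item, §L2(iii)), brick L2(iii-c) — the last generic brick. An
equality row of the peeled LP is the identity `Σ_{darts (y,w) of D} (mid{y,w} − c y)·F_s({y,w}) = −(door term)`
for `D = S_{T,L} ∖ K` and a K-door `s = {p, q}` (`Peel.door_term_add_sum_eq_zero`). Its darts far from
`K` are exits of the STRIP, of the five classes `β`, `α` (two sides), `ε`, `ε̄`; on each of them

  `(mid{y,w} − c y) · F_s({y,w}) = (c q − c p)/2 · e^{i(3/8)W'} · Σ_γ x^{ℓ(γ)}`,

because the dart coefficient is the entrance coefficient turned by the winding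
(`Peel.hexCenter_sub_eq_exp_winding_mul`) and the winding of EVERY walk to that exit is the class
value minus the prefix winding (`Peel.far_winding_beta / alpha / eps`). Hence, for a complex
multiplier `u` whose five numbers `Re(ū e^{i(3/8)W'_class})` are `≥ 0` (these are reduced costs of
the certificate), the far part of the row `ū · (2/(c q − c p)) · Σ_far` has NONNEGATIVE real part, and
the row can be used as the inequality "local part ≤ right-hand side" with the far side dropped.

* `dart_term_eq` — termwise: `(mid{y,w} − c y)·weight(γ) = (c q − c p)/2 · e^{i(3/8)W(γ)} x^ℓ`;
* `re_far_dart_nonneg` — one far dart: `0 ≤ Re(ū · (2/(c q − c p)) · (mid − c)·F)` under the five sign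
  hypotheses;
* **`re_far_sum_nonneg`** — summed over all `y` of `D` outside any set `Loc` beyond which every
  boundary dart of `D` leaves the strip.
-/

noncomputable section

open scoped BigOperators Classical ComplexConjugate
open Literature.Probability.LatticeModels Literature.Probability.RandomPlanarGeometry.SAW
open Literature.Probability.RandomPlanarGeometry.SAW.HV
open Literature.Barriers.CriticalPhenomena.HexGreen (nbrs mem_nbrs_iff)

namespace Summit.CriticalPhenomena.SAWScalingLimit.Theorems.SAWDevelopingMapNoFoldBound.Peel

variable {T L : ℕ} {K : Finset HexVertex} {p q y w : HexVertex}

/-- The phase factor `e^{i(3/8)W}` of a real winding `W`. -/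
theorem exp_three_eighths_mul (W : ℝ) :
    Complex.exp ((W : ℂ) * Complex.I) * Complex.exp (-Complex.I * (5 / 8 : ℝ) * (W : ℂ)) =
      Complex.exp (Complex.I * (3 / 8 : ℝ) * (W : ℂ)) := by
  rw [← Complex.exp_add]
  congr 1
  push_cast
  ring

/-- **Termwise.** For a walk `γ` from the door `{p,q}` (`p` outside the domain) ending at `y` of the
exit `{y,w}`: `(mid{y,w} − c y) · e^{-i(5/8)W(γ)} x^ℓ = (c q − c p)/2 · e^{i(3/8)W(γ)} · x^ℓ`. -/
theorem dart_term_eq {Λ : Finset HexVertex} (γ : HexMidEdgeSAW Λ s(p, q) s(y, w)) (hp : p ∉ Λ)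
    (hpq : hexGraph.Adj p q) (hyw : hexGraph.Adj y w) (hne : γ.verts ≠ [])
    (hlast : γ.verts.getLast hne = y) (x : ℝ) :
    (hexMidpoint s(y, w) - hexCenter y) * γ.weight x (5 / 8) =
      (hexCenter q - hexCenter p) / 2 * (Complex.exp (Complex.I * (3 / 8 : ℝ) * (γ.winding : ℂ)) *
        (x : ℂ) ^ γ.length) := by
  have hdir := hexCenter_sub_eq_exp_winding_mul γ hp hpq hyw hne hlast
  have hmid : hexMidpoint s(y, w) - hexCenter y = (hexCenter w - hexCenter y) / 2 := by
    rw [hexMidpoint_mk]; ring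
  rw [hmid, hdir, HexMidEdgeSAW.weight, ← exp_three_eighths_mul]
  push_cast
  ring

/-- The real part of `ū · e^{i(3/8)W}` scaled by a nonnegative real mass keeps its sign. -/
theorem re_mul_ofReal_nonneg {u c : ℂ} {m : ℝ} (hc : 0 ≤ (conj u * c).re) (hm : 0 ≤ m) :
    0 ≤ (conj u * (c * (m : ℂ))).re := by
  have : conj u * (c * (m : ℂ)) = (conj u * c) * (m : ℂ) := by ring
  rw [this, Complex.mul_re, Complex.ofReal_re, Complex.ofReal_im, mul_zero, sub_zero]
  exact mul_nonneg hc hm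

/-- **One far dart.** Let `D = stripDom T L ∖ K`, a K-door `{p,q}` with a prefix walk `pre` through `K`,
an exit dart `(y, w)` of `D` that leaves the strip (`w ∉ stripDom T L`), and a multiplier `u` with
`Re(ū e^{i(3/8)W'}) ≥ 0` for the five far values `W' ∈ {0, ∓π, ±2π/3} − W(pre)`. Then
`0 ≤ Re(ū · (2/(c q − c p)) · (mid{y,w} − c y) · F_s({y,w}))`. -/
theorem re_far_dart_nonneg
    (pre : HexMidEdgeSAW (stripDom T L) s(ofHV wOut, ofHV hvOrigin) s(p, q))
    (hpre : pre.verts ≠ []) (hpreK : ∀ v ∈ pre.verts, v ∈ K) (hKS : K ⊆ stripDom T L)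
    (hO : ofHV hvOrigin ∈ K) (hpK : p ∈ K) (hqK : q ∉ K) (hq : q ∈ stripDom T L) (hpq : hexGraph.Adj p q)
    (hy : y ∈ stripDom T L \ K) (hyw : hexGraph.Adj y w) (hw : w ∉ stripDom T L) (u : ℂ)
    (hβ : 0 ≤ (conj u * Complex.exp (Complex.I * (3 / 8 : ℝ) * ((-pre.winding : ℝ) : ℂ))).re)
    (hαp : 0 ≤ (conj u * Complex.exp (Complex.I * (3 / 8 : ℝ) * ((-Real.pi - pre.winding : ℝ) : ℂ))).re)
    (hαm : 0 ≤ (conj u * Complex.exp (Complex.I * (3 / 8 : ℝ) * ((Real.pi - pre.winding : ℝ) : ℂ))).re)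
    (hεl : 0 ≤ (conj u * Complex.exp (Complex.I * (3 / 8 : ℝ) * ((2 * Real.pi / 3 - pre.winding : ℝ) : ℂ))).re)
    (hεr : 0 ≤ (conj u * Complex.exp (Complex.I * (3 / 8 : ℝ) * ((-(2 * Real.pi / 3) - pre.winding : ℝ) : ℂ))).re)
    (x : ℝ) (hx : 0 ≤ x) :
    0 ≤ (conj u * ((2 / (hexCenter q - hexCenter p)) * ((hexMidpoint s(y, w) - hexCenter y) *
      hexParafermionicObservable (stripDom T L \ K) s(p, q) x (5 / 8) s(y, w)))).re := by
  have hqp : hexCenter q - hexCenter p ≠ 0 := sub_ne_zero.2 (hexCenter_ne_of_adj hpq.symm)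
  have hpD : p ∉ stripDom T L \ K := fun h => (Finset.mem_sdiff.1 h).2 hpK
  -- termwise rewriting of the observable
  rw [observable_eq_sum_weight, Finset.mul_sum, Finset.mul_sum, Finset.mul_sum, Complex.re_sum]
  refine Finset.sum_nonneg fun γ _ => ?_
  have hne : γ.verts ≠ [] := by
    intro h
    have := γ.eq_of_nil h
    have hmem : w ∈ s(p, q) := this ▸ Sym2.mem_mk_right y w
    rcases Sym2.mem_iff.1 hmem with rfl | rfl
    · exact hw (hKS hpK)
    · exact hw hq
  have hlast : γ.verts.getLast hne = y := by
    rcases γ.getLast_eq_or hne with h | h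
    · exact h
    · have hm := γ.subset _ (List.getLast_mem hne)
      rw [h] at hm
      exact absurd (Finset.mem_sdiff.1 hm).1 hw
  have ht : Complex.exp (-Complex.I * ((5 / 8 : ℝ) : ℂ) * (γ.winding : ℂ)) * (x : ℂ) ^ γ.length =
      γ.weight x (5 / 8) := rfl
  rw [ht, dart_term_eq γ hpD hpq hyw hne hlast x]
  have e2 : (2 / (hexCenter q - hexCenter p)) * ((hexCenter q - hexCenter p) / 2 *
      (Complex.exp (Complex.I * (3 / 8 : ℝ) * (γ.winding : ℂ)) * (x : ℂ) ^ γ.length)) =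
      Complex.exp (Complex.I * (3 / 8 : ℝ) * (γ.winding : ℂ)) * ((x ^ γ.length : ℝ) : ℂ) := by
    push_cast
    field_simp
  rw [e2]
  have hm : (0 : ℝ) ≤ x ^ γ.length := pow_nonneg hx _
  -- the winding of `γ` is one of the five far values
  have hyS : y ∈ stripDom T L := (Finset.mem_sdiff.1 hy).1
  have hcls := (not_mem_stripV_iff_classes (mem_stripDom_iff.1 hyS)
    ((hexGraph_adj_iff_hvGraph_adj y w).1 hyw)).1 (fun h => hw (mem_stripDom_iff.2 h))
  rcases hcls with hα | hβ' | hε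
  · obtain ⟨hk, hW⟩ := far_winding_alpha pre γ hpre hpreK hKS hO hqK hq hpq hyw hw hne hα
    rcases lt_or_gt_of_ne hk with hk' | hk'
    · rw [Int.sign_eq_neg_one_of_neg hk'] at hW
      have : γ.winding = Real.pi - pre.winding := by rw [hW]; push_cast; ring
      rw [this]; exact re_mul_ofReal_nonneg hαm hm
    · rw [Int.sign_eq_one_of_pos hk'] at hW
      have : γ.winding = -Real.pi - pre.winding := by rw [hW]; push_cast; ring
      rw [this]; exact re_mul_ofReal_nonneg hαp hm
  · have hW := far_winding_beta pre γ hpre hpreK hKS hO hqK hq hpq hyw hw hne hβ'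
    have : γ.winding = -pre.winding := hW
    rw [this]; exact re_mul_ofReal_nonneg hβ hm
  · rcases far_winding_eps pre γ hpre hpreK hKS hO hqK hq hpq hyw hw hne hε with ⟨-, hW⟩ | ⟨-, hW⟩
    · rw [hW]; exact re_mul_ofReal_nonneg hεl hm
    · rw [hW]; exact re_mul_ofReal_nonneg hεr hm

/-- **Far positivity of a row.** With `Loc` any finite set beyond which every boundary dart of
`D = stripDom T L ∖ K` leaves the strip, the far part of the Duminil-Copin–Smirnov row of the K-door
`{p,q}`, normalised by the entrance coefficient and tested against `u`, has nonnegative real part. -/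
theorem re_far_sum_nonneg : ∀ {T L : ℕ} {K Loc : Finset HexVertex} {p q : HexVertex} (pre : HexMidEdgeSAW (stripDom T L) s(ofHV HV.wOut, ofHV hvOrigin) s(p, q)), pre.verts ≠ [] → (∀ v ∈ pre.verts, v ∈ K) → K ⊆ stripDom T L → ofHV hvOrigin ∈ K → p ∈ K → q ∉ K → q ∈ stripDom T L → hexGraph.Adj p q → (∀ y ∈ stripDom T L \ K, y ∉ Loc → ∀ w : HexVertex, hexGraph.Adj y w → w ∉ stripDom T L \ K → w ∉ stripDom T L) → ∀ (u : ℂ) (x : ℝ), 0 ≤ x → 0 ≤ (conj u * Complex.exp (Complex.I * (3 / 8 : ℝ) * ((-pre.winding : ℝ) : ℂ))).re → 0 ≤ (conj u * Complex.exp (Complex.I * (3 / 8 : ℝ) * ((-Real.pi - pre.winding : ℝ) : ℂ))).re → 0 ≤ (conj u * Complex.exp (Complex.I * (3 / 8 : ℝ) * ((Real.pi - pre.winding : ℝ) : ℂ))).re → 0 ≤ (conj u * Complex.exp (Complex.I * (3 / 8 : ℝ) * ((2 * Real.pi / 3 - pre.winding : ℝ) : ℂ))).re → 0 ≤ (conj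 u * Complex.exp (Complex.I * (3 / 8 : ℝ) * ((-(2 * Real.pi / 3) - pre.winding : ℝ) : ℂ))).re → 0 ≤ (conj u * ((2 / (hexCenter q - hexCenter p)) * ∑ y ∈ ((stripDom T L \ K) \ Loc), ∑ w ∈ (Literature.Barriers.CriticalPhenomena.HexGreen.nbrs y).filter (· ∉ stripDom T L \ K), (hexMidpoint s(y, w) - hexCenter y) * hexParafermionicObservable (stripDom T L \ K) s(p, q) x (5 / 8) s(y, w))).re := by
  intro T L K Loc p q pre hpre hpreK hKS hO hpK hqK hq hpq hLoc u x hx hβ hαp hαm hεl hεr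
  rw [Finset.mul_sum, Finset.mul_sum, Complex.re_sum]
  refine Finset.sum_nonneg fun y hy => ?_
  obtain ⟨hyD, hyL⟩ := Finset.mem_sdiff.1 hy
  rw [Finset.mul_sum, Finset.mul_sum, Complex.re_sum]
  refine Finset.sum_nonneg fun w hw' => ?_
  obtain ⟨hwn, hwD⟩ := Finset.mem_filter.1 hw'
  have hyw : hexGraph.Adj y w := (mem_nbrs_iff y w).1 hwn
  have hw : w ∉ stripDom T L := hLoc y hyD hyL w hyw hwD
  exact re_far_dart_nonneg pre hpre hpreK hKS hO hpK hqK hq hpq hyD hyw hw u hβ hαp hαm hεl hεr x hx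

end Summit.CriticalPhenomena.SAWScalingLimit.Theorems.SAWDevelopingMapNoFoldBound.Peel
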